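import Summits.BirchSwinnertonDyer.Rank1Residual.P2.CornerFTwoModelClasses
import HarnessLib

/-!
# Leaf CornerF @ `p = 2` — THE MODEL ATLAS, file 6 (cell `bsd-print-cf2`, D-0131 (2) print tier,
# typer ty2): the two INERT layer-2 cruxes of route `PrintCf2` (rev 5, j-currency) IN MODEL CURRENCY

HONEST FRAMING (cell `bsd-print-cf2`, HOME `run/shared/lean/pub/bsd-print-cf2/`, verbatim in every
file): the partition leaf is `CornerF W 2` — `W/ℚ` globally minimal elliptic WITH CM and
`ord_{s=1} L(E,s) = 1`, at the prime `2` (rung leaf `WAllCornerFTwo`; OPEN AS A CLASS). Route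
`PrintCf2` rev 5 (planner, 2026-08-27) splits the inert crux 20363 in `j`-currency:
item stmt-BirchSwinnertonDyer-20671 `InertJZeroOfFacts` (`𝔅_inert → ∀ W, r_an = 1 → j(W) = 0 →
BSD(W,2)`) and item stmt-BirchSwinnertonDyer-20672 `InertOddHeegnerJOfFacts` (`𝔅_inert → ∀ W,
r_an = 1 → j(W) ∈ {−32768, −884736, −884736000, −147197952000, −262537412640768000} → BSD(W,2)`);
the two non-maximal `ℚ(√−3)` values `j ∈ {54000, −12288000}` are folded onto `j = 0` by p4's isogeny
bridges (p540203/p542985). This file rewrites the CONSEQUENTS of the two children through the atlas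
(files 1–2): `j = 0` ⟺ the sextic family `y² = x³ + B`, `B ∈ ℤ∖{0}` — equivalently, per cube-class,
the quadratic-twist families of the bases `y² = x³ + B₀` (`(y² = x³ + B₀)^{(d)} = (y² = x³ + d³B₀)`,
tree `quadraticTwist_mk_a₆`), which is the currency of Kriz–Li 2019 Thm. 1.12 (a base `E` with
`E(ℚ)[2] = 0`, its twists `E^{(d)}`, `d ∈ 𝒩`; e.g. `243a1 ≅ (y² = x³ − 48)`, lit g2 p544340); the five
odd Heegner `j` ⟺ the five square-free twist families of `cm11 = 121b1`, `cm19 = 361a1`, `cm43`,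
`cm67`, `cm163`, one `j` at a time (`jEq_iff_twists`) and jointly. Fact-free: NO arithmetic fact, NO
definition, NO named fact (D-0026).

## Contents

* `jZero_iff_sextics` — consequent of 20671 ⟺ `∀ B ∈ ℤ∖{0}`, every globally minimal model of
  `y² = x³ + B` of analytic rank one satisfies `BSD(·,2)`;
* `jZero_iff_sexticTwistFamilies` — the same ⟺ `∀ B₀ ∈ ℤ∖{0}, ∀ d ∈ ℤ∖{0}` square-free, every
  globally minimal model of `(y² = x³ + B₀)^{(d)}` of analytic rank one satisfies `BSD(·,2)`
  (Kriz–Li door currency; `d = 1` recovers the sextic);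
* `jEq_iff_twists` — for any base `E` with `j(E) ∉ {0, 1728}`: "`BSD(W,2)` for every minimal `W`
  with `r_an = 1` and `j(W) = j(E)`" ⟺ "… for every minimal model of a square-free twist of `E`";
* `oddHeegnerJ_iff_twists` — consequent of 20672 ⟺ the five twist families.

References: [SilvermanAEC2009] X.5 Prop. 5.4 / Cor. 5.4.1; [SilvermanATAEC1994] App. A §3; [KrizLi2019]
Thm. 1.12 (= FMS Thm. 5.1 (2)), §6 Table 1; HOME/STATUS planner 15:39:04Z (rev 5 items);
`P2/CornerFTwoModelAtlas.lean`, `P2/CornerFTwoModelClasses.lean`.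
-/

noncomputable section

open scoped Classical

open WeierstrassCurve Literature.NumberTheory.EllipticCurves
  Literature.NumberTheory.EllipticCurves.Rank1Residual

set_option autoImplicit false

namespace Summit.BirchSwinnertonDyer.Rank1Residual.P2.CornerFTwo

open Atlas

/-! ## §1 `j = 0` (item 20671) -/

/-- **`j = 0` IN MODEL CURRENCY** (consequent of item stmt-BirchSwinnertonDyer-20671
`InertJZeroOfFacts`): "`BSD(W,2)` for every globally minimal `W/ℚ` of analytic rank one with
`j(W) = 0`" ⟺ "for every `B ∈ ℤ∖{0}`, `BSD(W,2)` for every globally minimal model `W` of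
`y² = x³ + B` of analytic rank one". [cite: SilvermanAEC2009, X.5 Prop. 5.4 (iii)] -/
theorem jZero_iff_sextics :
    (∀ (W : WeierstrassCurve ℚ) [W.IsElliptic] [W.IsGloballyMinimal],
        W.analyticRank = 1 → W.j = 0 → BSDp W 2) ↔
      (∀ B : ℤ, B ≠ 0 →
        ∀ (W : WeierstrassCurve ℚ) [W.IsElliptic] [W.IsGloballyMinimal],
          (∃ C : VariableChange ℚ, C • (⟨0, 0, 0, 0, (B : ℚ)⟩ : WeierstrassCurve ℚ) = W) →
          W.analyticRank = 1 → BSDp W 2) := by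
  constructor
  · intro h B hB W _ _ hW hr
    obtain ⟨C, hC⟩ := hW
    have hB' : (B : ℚ) ≠ 0 := by exact_mod_cast hB
    exact h W hr (j_eq_zero_of_smul_sextic hB' hC)
  · intro h W _ _ hr hj
    obtain ⟨B, hB, hW⟩ := exists_smul_sextic_int_of_j_eq_zero hj
    exact h B hB W hW hr

/-- **`j = 0` IN KRIZ–LI DOOR CURRENCY**: the same statement ⟺ "for every base `B₀ ∈ ℤ∖{0}` and every
square-free `d ∈ ℤ∖{0}`, `BSD(W,2)` for every globally minimal model `W` of analytic rank one of the
quadratic twist `(y² = x³ + B₀)^{(d)}`" (`= y² = x³ + d³B₀` on the nose, `quadraticTwist_mk_a₆`; `d = 1`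
gives back every sextic). A Kriz–Li closer at a base `E ≅ y² = x³ + B₀` with `E(ℚ)[2] = 0` discharges
the `d ∈ 𝒩` part of one `B₀`-slice. [cite: KrizLi2019, Thm. 1.12 (arXiv:1606.03172 p. 4)]
[cite: SilvermanAEC2009, X.5 Prop. 5.4 (iii)] -/
theorem jZero_iff_sexticTwistFamilies :
    (∀ (W : WeierstrassCurve ℚ) [W.IsElliptic] [W.IsGloballyMinimal],
        W.analyticRank = 1 → W.j = 0 → BSDp W 2) ↔
      (∀ B₀ : ℤ, B₀ ≠ 0 → ∀ d : ℤ, d ≠ 0 → Squarefree d →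
        ∀ (W : WeierstrassCurve ℚ) [W.IsElliptic] [W.IsGloballyMinimal],
          (∃ C : VariableChange ℚ,
            C • (⟨0, 0, 0, 0, (B₀ : ℚ)⟩ : WeierstrassCurve ℚ).quadraticTwist (d : ℚ) = W) →
          W.analyticRank = 1 → BSDp W 2) := by
  rw [jZero_iff_sextics]
  constructor
  · intro h B₀ hB₀ d hd _ W _ _ hW hr
    obtain ⟨C, hC⟩ := hW
    rw [quadraticTwist_mk_a₆] at hC
    have e : ((d : ℚ)) ^ 3 * (B₀ : ℚ) = ((d ^ 3 * B₀ : ℤ) : ℚ) := by push_cast; ring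
    rw [e] at hC
    exact h (d ^ 3 * B₀) (mul_ne_zero (pow_ne_zero 3 hd) hB₀) W ⟨C, hC⟩ hr
  · intro h B hB W _ _ hW hr
    obtain ⟨C, hC⟩ := hW
    refine h B hB 1 one_ne_zero squarefree_one W ⟨C, ?_⟩ hr
    rw [quadraticTwist_mk_a₆]; simpa using hC

/-! ## §2 One `j ∉ {0, 1728}` at a time; the five odd Heegner fields (item 20672) -/

/-- **A single `j ∉ {0, 1728}` in model currency.** For a base `E/ℚ` with `j(E) ≠ 0, 1728`:
"`BSD(W,2)` for every globally minimal `W` of analytic rank one with `j(W) = j(E)`" ⟺ "for every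
square-free `d ∈ ℤ∖{0}`, `BSD(W,2)` for every globally minimal model `W` of analytic rank one of
`E^{(d)}`". [cite: SilvermanAEC2009, X.5 Prop. 5.4 and Cor. 5.4.1] -/
theorem jEq_iff_twists (E : WeierstrassCurve ℚ) [E.IsElliptic] (h0 : E.j ≠ 0) (h1728 : E.j ≠ 1728) :
    (∀ (W : WeierstrassCurve ℚ) [W.IsElliptic] [W.IsGloballyMinimal],
        W.analyticRank = 1 → W.j = E.j → BSDp W 2) ↔
      (∀ d : ℤ, d ≠ 0 → Squarefree d →
        ∀ (W : WeierstrassCurve ℚ) [W.IsElliptic] [W.IsGloballyMinimal],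
          (∃ C : VariableChange ℚ, C • E.quadraticTwist (d : ℚ) = W) →
          W.analyticRank = 1 → BSDp W 2) := by
  constructor
  · intro h d hd _ W _ _ hW hr
    obtain ⟨C, hC⟩ := hW
    have hd' : (d : ℚ) ≠ 0 := by exact_mod_cast hd
    exact h W hr (j_eq_of_smul_twist hd' hC)
  · intro h W _ _ hr hj
    obtain ⟨d, hd, hsq, hW⟩ := exists_smul_twist_of_j_eq hj h0 h1728
    exact h d hd hsq W hW hr

/-- **THE FIVE ODD HEEGNER FIELDS IN MODEL CURRENCY** (consequent of item stmt-BirchSwinnertonDyer-20672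
`InertOddHeegnerJOfFacts`): "`BSD(W,2)` for every globally minimal `W` of analytic rank one with
`j(W) ∈ {−32768, −884736, −884736000, −147197952000, −262537412640768000}`" ⟺ the conjunction over
the five bases `cm11 = 121b1`, `cm19 = 361a1`, `cm43 = 1849a1`, `cm67 = 4489a1`, `cm163 = 26569a1` of
"`BSD(W,2)` for every globally minimal model of analytic rank one of a square-free twist of the base".
No theorem in print at `2` on any of the five (lit-sheet §6: nothing for the odd Heegner fields).
[cite: SilvermanAEC2009, X.5 Prop. 5.4 and Cor. 5.4.1] [cite: SilvermanATAEC1994, App. A §3] -/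
theorem oddHeegnerJ_iff_twists :
    (∀ (W : WeierstrassCurve ℚ) [W.IsElliptic] [W.IsGloballyMinimal],
        W.analyticRank = 1 →
        (W.j = -32768 ∨ W.j = -884736 ∨ W.j = -884736000 ∨ W.j = -147197952000 ∨
          W.j = -262537412640768000) → BSDp W 2) ↔
      (∀ d : ℤ, d ≠ 0 → Squarefree d →
        ∀ (W : WeierstrassCurve ℚ) [W.IsElliptic] [W.IsGloballyMinimal],
          (∃ C : VariableChange ℚ, C • cm11.quadraticTwist (d : ℚ) = W) →
          W.analyticRank = 1 → BSDp W 2) ∧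
      (∀ d : ℤ, d ≠ 0 → Squarefree d →
        ∀ (W : WeierstrassCurve ℚ) [W.IsElliptic] [W.IsGloballyMinimal],
          (∃ C : VariableChange ℚ, C • cm19.quadraticTwist (d : ℚ) = W) →
          W.analyticRank = 1 → BSDp W 2) ∧
      (∀ d : ℤ, d ≠ 0 → Squarefree d →
        ∀ (W : WeierstrassCurve ℚ) [W.IsElliptic] [W.IsGloballyMinimal],
          (∃ C : VariableChange ℚ, C • cm43.quadraticTwist (d : ℚ) = W) →
          W.analyticRank = 1 → BSDp W 2) ∧
      (∀ d : ℤ, d ≠ 0 → Squarefree d →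
        ∀ (W : WeierstrassCurve ℚ) [W.IsElliptic] [W.IsGloballyMinimal],
          (∃ C : VariableChange ℚ, C • cm67.quadraticTwist (d : ℚ) = W) →
          W.analyticRank = 1 → BSDp W 2) ∧
      (∀ d : ℤ, d ≠ 0 → Squarefree d →
        ∀ (W : WeierstrassCurve ℚ) [W.IsElliptic] [W.IsGloballyMinimal],
          (∃ C : VariableChange ℚ, C • cm163.quadraticTwist (d : ℚ) = W) →
          W.analyticRank = 1 → BSDp W 2) := by
  have e11 := jEq_iff_twists cm11 (by rw [j_cm11]; norm_num) (by rw [j_cm11]; norm_num)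
  have e19 := jEq_iff_twists cm19 (by rw [j_cm19]; norm_num) (by rw [j_cm19]; norm_num)
  have e43 := jEq_iff_twists cm43 (by rw [j_cm43]; norm_num) (by rw [j_cm43]; norm_num)
  have e67 := jEq_iff_twists cm67 (by rw [j_cm67]; norm_num) (by rw [j_cm67]; norm_num)
  have e163 := jEq_iff_twists cm163 (by rw [j_cm163]; norm_num) (by rw [j_cm163]; norm_num)
  rw [j_cm11] at e11; rw [j_cm19] at e19; rw [j_cm43] at e43; rw [j_cm67] at e67
  rw [j_cm163] at e163
  rw [← e11, ← e19, ← e43, ← e67, ← e163]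
  constructor
  · intro h
    exact ⟨fun W _ _ hr hj => h W hr (Or.inl hj), fun W _ _ hr hj => h W hr (Or.inr (Or.inl hj)),
      fun W _ _ hr hj => h W hr (Or.inr (Or.inr (Or.inl hj))),
      fun W _ _ hr hj => h W hr (Or.inr (Or.inr (Or.inr (Or.inl hj)))),
      fun W _ _ hr hj => h W hr (Or.inr (Or.inr (Or.inr (Or.inr hj))))⟩
  · rintro ⟨h11, h19, h43, h67, h163⟩ W _ _ hr hj
    rcases hj with hj | hj | hj | hj | hj
    · exact h11 W hr hj
    · exact h19 W hr hj
    · exact h43 W hr hj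
    · exact h67 W hr hj
    · exact h163 W hr hj

end Summit.BirchSwinnertonDyer.Rank1Residual.P2.CornerFTwo

end
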